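import Literature.Geometry.Riemannian.ChangGurskyYangProofs
import HarnessLib

/-!
# The Gursky–Viaclovsky `σ₂` continuity path on a four-manifold, with the Chang–Gursky–Yang Weyl weight

Definitions (real, with bodies; NO named facts — this file is meant to sit in the import cone of
routes) of the vocabulary of the continuity method of Gursky–Viaclovsky 2003 for the fully
nonlinear conformal equation `σ₂^{1/2}(g⁻¹A^t_{g̃}) = f e^{2u}`, `g̃ = e^{-2u} g`, on a closed
Riemannian four-manifold of positive scalar curvature (Gursky–Viaclovsky 2003, §1: the tensor
`A^t_g = ½(Ric_g - (t/6) R_g g)` and the equation (PDE); §3, equation (path): the one-parameter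
family `σ₂^{1/2}(g⁻¹A^t_{u_t}) = f(x) e^{2u_t}`, `t ∈ [δ, 1]`, started at `u ≡ 0`, `t = δ`; §5:
the set `𝒮` of parameters at which an admissible solution exists, shown non-empty, open and
closed),
CARRYING THE WEYL WEIGHT of Chang–Gursky–Yang 2003, Thm. 1.4 with `α = 1` ((1.9)–(1.10): from
`∫σ₂(A) dV - ¼∫|W|² dV > 0` to a conformal metric with `σ₂(A) - ¼|W|² > 0` pointwise), read on the
conformal metric `h = e^{-2u} g` itself and written over the tree's curvature vocabulary
(`Literature/Geometry/Riemannian/{WeylEnergy,ChangGurskyYangProofs}.lean`):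

* `pathOperator h t x = σ₂(A_h)(x) - ¼|W_h|²(x) + (1-t)(2-t) R_h(x)²/6` — the left-hand side of the
  weighted path equation at parameter `t`, as a function on `M`;
* `IsPathSolution g h u t q` — `h = e^{-2u} g` is a smooth admissible (`R_h > 0`) solution of
  `pathOperator h t = q · e^{8u}` (right-hand side `q : M → ℝ` fixed on the background `g`);
* `Solvable g t q` — Gursky–Viaclovsky's solvable set `𝒮 = {t | ∃ an admissible solution at t}`;
* `kappa h = ∫σ₂(A_h) dV_h - ¼ ∫|W_h|² dV_h` — the real number on the left of Chang–Gursky–Yang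
  2003, (1.2), a conformal invariant by Chern–Gauss–Bonnet (1.1).

These four definitions are exactly the vocabulary over which the crux line `gv-continuity-path`
of `Summits/SmoothPoincare4/…/Cruxes/ChangGurskyYang` states its registered analytic inputs
(start of the path, a priori estimates, openness, closedness); they are landed here, tree-side and
sorry-free, so that supporting proposals can import them. Only algebraic API is proved here.

## Dictionary: Gursky–Viaclovsky's normalisation versus the tree's

The tree (Chang–Gursky–Yang 2003, §1) works with the Weyl–Schouten tensor `A = Ric - (R/6) g`
and `σ₂(A) := σ₂(g⁻¹A) = -½|E|² + R²/24` (`PseudoRiemannianMetric.sigma2WeylSchouten`,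
`sigma2WeylSchouten_eq`), the `(0,4)`-norm `|W|² = W_{ijkl}W^{ijkl}` (`weylNormSq`), `R = scalarCurvature`,
`∫σ₂(A) dV = sigma2WeylSchoutenIntegral`, `∫|W|² dV = weylEnergy ∈ ℝ≥0∞`. Gursky–Viaclovsky's
`A^1 = ½(Ric - (R/6) g) = ½ A` is half of it, so `σ₂(g⁻¹A^1) = ¼ σ₂(A)` (their §1:
"`𝓕₂([g]) = 4∫σ₂(g⁻¹A^1_g) dvol_g`", `= ∫σ₂(A) dV`) and `σ₁(g⁻¹A^1) = R/6`; by the proof of their Prop. 4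
(Lemma 24 of [Viaclovsky 2000]), `σ₂(A^t) = σ₂(A^1) + (3/2)(1-t)(2-t) σ₁(A^1)² = σ₂(A^1) + (1-t)(2-t)R²/24`,
whence `4 σ₂(h⁻¹A^t_h) = σ₂(A_h) + (1-t)(2-t) R_h²/6` — the Weyl-free part of `pathOperator h t`.
For `h = g̃ = e^{-2u} g` one has `A^t_u = A^t_{g̃}` (the transformation law of `A^t` in §1 and the
definition of `A^t_u` in §2, before Prop. 2) and `g⁻¹ = e^{-2u} g̃⁻¹`,
so `σ₂(g⁻¹A^t_u) = e^{-4u} σ₂(g̃⁻¹A^t_{g̃})` (proof of Prop. 4: "`e^{4u_t} f² = σ₂(g⁻¹A^t_{u_t}) =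
e^{-4u_t}(σ₂(g̃⁻¹A^1_{u_t}) + (1/24)(1-t)(2-t) R_{g̃}²)`"), and the `(0,4)`-norm of the Weyl tensor
obeys `|W_{g̃}|²_{g̃} = e^{4u} |W_g|²_g` pointwise. Hence the path equation with the `x`-dependent
Weyl weight `ψ_W = (1/16)|W_g|²_g` added to the right-hand side,
`σ₂(g⁻¹A^t_u) = (1/16)|W_g|²_g + f² e^{4u}` (Gursky–Viaclovsky, p. 4: "the choice of the right
hand side in (PDE) is quite flexible; the key requirement is simply that the exponent is a
positive multiple of `u`"), multiplied by `4 e^{4u}`, reads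
`σ₂(A_{g̃}) + (1-t)(2-t) R_{g̃}²/6 - ¼|W_{g̃}|²_{g̃} = 4 f² e^{8u}`, i.e.
`pathOperator g̃ t = q e^{8u}` with `q = 4f²`; Gursky–Viaclovsky's own (path) is the case without
the Weyl term. At `t = 1` the operator is `σ₂(A_h) - ¼|W_h|²`, the quantity of Chang–Gursky–Yang
2003, (1.10) (`α = 1`), so a solution at `t = 1` with `q > 0` is a conformal metric with
`¼|W|² < σ₂(A)` pointwise (`IsPathSolution.quarter_weylNormSq_lt`) and `R > 0`.

Admissibility: Gursky–Viaclovsky ask `A^t_u ∈ Γ₂⁺ = {σ₂ > 0} ∩ {σ₁ > 0}` (Def. 1). For a solution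
with positive right-hand side `σ₂ > 0` is automatic, and `σ₁(g⁻¹A^t_u) = e^{-2u}(3-2t) R_{g̃}/6`, so
for `t ≤ 1` membership in `Γ₂⁺` is `R_{g̃} > 0` — the clause recorded in `IsPathSolution`.
Regularity: `𝒮` is defined in §5 with `u_t ∈ C^{2,α}`, and "since `f ∈ C^∞(M)`, it follows from
classical elliptic regularity theory that `u_t ∈ C^∞(M)`" (ibid.); `IsPathSolution` records smooth
solutions (`u` is `C^∞` and `h` is a `C^∞` metric carrying a Levi-Civita connection).

## What is NOT here

No existence statement: Gursky–Viaclovsky's Thm. 1, the ellipticity/invertibility of the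
linearisation (Prop. 2), the `C⁰`, `C¹`, `C^{2,α}` estimates (Props. 3–6) and the continuity
argument of §5 are not vended (neither as theorems nor as named facts); nor is the conformal
invariance of `kappa` (it needs Chern–Gauss–Bonnet, the named fact `chernGaussBonnet_four` of
`ChernGaussBonnetFour.lean`, plus the proved `weylEnergy_conformal_sq_four` of
`Lorentzian/WeylConformal.lean` — deliberately not imported, to keep this definitions file light).
The model space is fixed to `ℝ⁴` charts and `C^∞` metrics, the generality the consumers use; the
underlying pointwise quantities (`sigma2WeylSchouten`, `weylNormSq`, …) are the tree's general ones.

## References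

* M. J. Gursky, J. A. Viaclovsky, *A fully nonlinear equation on four-manifolds with positive
  scalar curvature*, J. Differential Geom. 63 (2003) 131–154, arXiv:math/0301350: §1 (`𝓕₂`,
  `A^t_g`, Thm. 1, (PDE)), §2 (Def. 1: `Γ₂⁺`; `A^t_u`; Prop. 2), §3 ((path), Props. 3–4), §5 (the
  set `𝒮`, Prop. 6, proof of Thm. 1). Equation numbers are not quoted: the held text is the arXiv
  source, whose displays carry the labels (PDE), (path) used here. [GurskyViaclovsky2003]
* S.-Y. A. Chang, M. J. Gursky, P. C. Yang, *A conformally invariant sphere theorem in four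
  dimensions*, Publ. Math. IHÉS 98 (2003) 105–143: §1, (1.1)–(1.2) (p. 111), Thm. 1.4 and
  (1.9)–(1.10) (pp. 112–113). [ChangGurskyYang2003]
* J. M. Lee, *Introduction to Riemannian Manifolds*, 2nd ed. (2018), Prop. 8.36 (round sphere).
  [Lee2018]
* A. L. Besse, *Einstein Manifolds* (1987), 1.118–1.119 (`W = 0` for constant curvature). [Besse1987]
-/

noncomputable section

open scoped Manifold ContDiff

namespace Literature.Geometry.Riemannian.GurskyViaclovskyPath

open Literature.Geometry.Lorentzian (PseudoRiemannianMetric)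
open Literature.Geometry.Lorentzian.PseudoRiemannianMetric

/-! ### The weighted path operator -/

/-- **The Weyl-weighted Gursky–Viaclovsky path operator, read on the conformal metric itself**:
for a `C^∞` metric `h` with its Levi-Civita connection on a `4`-manifold and `t ∈ ℝ`,
`pathOperator h t x = σ₂(A_h)(x) - ¼|W_h|²(x) + (1-t)(2-t)·R_h(x)²/6`, with the tree's
`A = Ric - (R/6) g`, `σ₂(A) = -½|E|² + R²/24` (`sigma2WeylSchouten`), the `(0,4)`-norm `|W|²`
(`weylNormSq`) and `R = scalarCurvature`. In Gursky–Viaclovsky's normalisation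
(`A^t = ½(Ric - (t/6)R g)`, `σ₂(A^t) = σ₂(A^1) + (1/24)(1-t)(2-t)R²`, proof of Prop. 4) this is
`4·[σ₂(h⁻¹A^t_h) - (1/16)|W_h|²_h]`, and for `h = e^{-2u} g` it equals
`4e^{4u}·[σ₂(g⁻¹A^t_u) - (1/16)|W_g|²_g]`, so their path equation (path) of §3 with the Weyl weight
`(1/16)|W_g|²_g` added to the right-hand side `f² e^{4u}` reads `pathOperator h t = 4f²·e^{8u}`
(module docstring, "Dictionary"). The Weyl term is the `α = 1` weight of Chang–Gursky–Yang 2003,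
(1.9)–(1.10); at `t = 1` the operator is their `σ₂(A) - ¼|W|²` (`pathOperator_one`).
[cite: GurskyViaclovsky2003, §1 (A^t), §3 (path) and proof of Prop. 4]
[cite: ChangGurskyYang2003, (1.10)] -/
def pathOperator {M : Type*} [TopologicalSpace M] [ChartedSpace (EuclideanSpace ℝ (Fin 4)) M]
    [IsManifold (𝓡 4) ∞ M]
    (h : PseudoRiemannianMetric (𝓡 4) ∞ (EuclideanSpace ℝ (Fin 4)) (TangentSpace (𝓡 4) : M → Type _))
    [h.HasLeviCivita] (t : ℝ) (x : M) : ℝ :=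
  h.sigma2WeylSchouten x - 1 / 4 * h.weylNormSq x + (1 - t) * (2 - t) * h.scalarCurvature x ^ 2 / 6

/-- **A smooth admissible solution of the weighted path equation at parameter `t`** with
right-hand side `q` on the background `g` (Gursky–Viaclovsky 2003, §5, the membership condition of
the set `𝒮`, for the weighted equation and read on the conformal metric): `h` is a Riemannian
metric CONFORMAL to `g` with factor `e^{-2u}` (`h = g̃ = e^{-2u} g`), `u` is `C^∞`, `h` has positive
scalar curvature — admissibility `A^t_u ∈ Γ₂⁺ = {σ₂ > 0} ∩ {σ₁ > 0}` (ibid. Def. 1): for a positive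
right-hand side `σ₂ > 0` is automatic and `σ₁(g⁻¹A^t_u) = e^{-2u}(3-2t)R_h/6`, so for `t ≤ 1` the
cone condition is `R_h > 0` — and the equation `pathOperator h t = q·e^{8u}` holds pointwise. The
metric `h` is a datum of its own (a `C^∞` `PseudoRiemannianMetric` carrying a Levi-Civita
connection, through which `σ₂(A_h)`, `|W_h|²`, `R_h` are formed) tied to `(g, u)` by the conformality
clause. [cite: GurskyViaclovsky2003, §5 (the set 𝒮) and Def. 1] -/
def IsPathSolution {M : Type*} [TopologicalSpace M] [ChartedSpace (EuclideanSpace ℝ (Fin 4)) M]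
    [IsManifold (𝓡 4) ∞ M]
    (g h : PseudoRiemannianMetric (𝓡 4) ∞ (EuclideanSpace ℝ (Fin 4)) (TangentSpace (𝓡 4) : M → Type _))
    [h.HasLeviCivita] (u : M → ℝ) (t : ℝ) (q : M → ℝ) : Prop :=
  h.IsRiemannian ∧ ContMDiff (𝓡 4) 𝓘(ℝ) ∞ u ∧
    (∀ (x : M) (v w : TangentSpace (𝓡 4) x), h.val x v w = Real.exp (-2 * u x) * g.val x v w) ∧
    (∀ x : M, 0 < h.scalarCurvature x) ∧
    ∀ x : M, pathOperator h t x = q x * Real.exp (8 * u x)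

/-- **Gursky–Viaclovsky's solvable set `𝒮`**: `Solvable g t q` says that `t ∈ 𝒮`, i.e. the weighted
path equation at parameter `t` with right-hand side `q` has a smooth admissible solution — some
`C^∞` metric `h = e^{-2u} g` with a Levi-Civita connection and `IsPathSolution g h u t q`
(Gursky–Viaclovsky 2003, §5: "`𝒮 = {t ∈ [δ, t₀] | ∃ a solution u_t ∈ C^{2,α}(M) of (path) with
A^t_{u_t} ∈ Γ₂⁺}`"; the interval constraint is left to the user, and solutions are recorded smooth,
as they are by elliptic regularity, ibid.). [cite: GurskyViaclovsky2003, §5 (the set 𝒮)] -/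
def Solvable {M : Type*} [TopologicalSpace M] [ChartedSpace (EuclideanSpace ℝ (Fin 4)) M]
    [IsManifold (𝓡 4) ∞ M]
    (g : PseudoRiemannianMetric (𝓡 4) ∞ (EuclideanSpace ℝ (Fin 4)) (TangentSpace (𝓡 4) : M → Type _))
    (t : ℝ) (q : M → ℝ) : Prop :=
  ∃ (h : PseudoRiemannianMetric (𝓡 4) ∞ (EuclideanSpace ℝ (Fin 4)) (TangentSpace (𝓡 4) : M → Type _))
    (_ : h.HasLeviCivita) (u : M → ℝ), IsPathSolution g h u t q

/-- **The conformal invariant `κ(h) = ∫_M σ₂(A_h) dV_h - ¼ ∫_M |W_h|² dV_h`** — the real number on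
the left-hand side of Chang–Gursky–Yang 2003, (1.2) (assumption (0.5) of their Thm. A rewritten by
Chern–Gauss–Bonnet (1.1); conformally invariant because `∫|W|² dV` and, by (1.1), `∫σ₂(A) dV` are),
built from `sigma2WeylSchoutenIntegral` and the Weyl energy `weylEnergy ∈ ℝ≥0∞` converted to a real
number (`weylEnergy < ⊤` on closed manifolds, `weylEnergy_lt_top`; junk value `toReal ⊤ = 0`
otherwise, and both integrals are the junk value `0` for a non-Riemannian `h`). The letter `κ` is
the crux line's; it is NOT the invariant called `κ` in Chang–Gursky–Yang's (1.12).
[cite: ChangGurskyYang2003, (1.2) p. 111] -/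
def kappa {M : Type*} [TopologicalSpace M] [T2Space M] [ChartedSpace (EuclideanSpace ℝ (Fin 4)) M]
    [IsManifold (𝓡 4) ∞ M]
    (h : PseudoRiemannianMetric (𝓡 4) ∞ (EuclideanSpace ℝ (Fin 4)) (TangentSpace (𝓡 4) : M → Type _))
    [h.HasLeviCivita] : ℝ :=
  h.sigma2WeylSchoutenIntegral - 1 / 4 * h.weylEnergy.toReal

/-! ### Algebraic API -/

section API

variable {M : Type*} [TopologicalSpace M] [ChartedSpace (EuclideanSpace ℝ (Fin 4)) M]
  [IsManifold (𝓡 4) ∞ M]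

/-- **At `t = 1` the path operator is Chang–Gursky–Yang's `σ₂(A) - ¼|W|²`** (the quantity of
(1.10) with `α = 1`; in Gursky–Viaclovsky's terms `A^1` is the Schouten tensor and the
`(1-t)(2-t)` correction vanishes). [cite: ChangGurskyYang2003, (1.10)] -/
theorem pathOperator_one
    (h : PseudoRiemannianMetric (𝓡 4) ∞ (EuclideanSpace ℝ (Fin 4)) (TangentSpace (𝓡 4) : M → Type _))
    [h.HasLeviCivita] (x : M) :
    pathOperator h 1 x = h.sigma2WeylSchouten x - 1 / 4 * h.weylNormSq x := by
  simp [pathOperator]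

/-- **`σ₂(A^t) = σ₂(A^1) + (1/24)(1-t)(2-t)R²` in the tree's normalisation** (Gursky–Viaclovsky
2003, proof of Prop. 4, times `4`): `pathOperator h t = pathOperator h 1 + (1-t)(2-t)R_h²/6`.
[cite: GurskyViaclovsky2003, proof of Prop. 4] -/
theorem pathOperator_eq_pathOperator_one_add
    (h : PseudoRiemannianMetric (𝓡 4) ∞ (EuclideanSpace ℝ (Fin 4)) (TangentSpace (𝓡 4) : M → Type _))
    [h.HasLeviCivita] (t : ℝ) (x : M) :
    pathOperator h t x = pathOperator h 1 x + (1 - t) * (2 - t) * h.scalarCurvature x ^ 2 / 6 := by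
  simp only [pathOperator]
  ring

/-- **The path operator is antitone in `t` below `t = 3/2`**: for `t ≤ t'` with `t + t' ≤ 3`,
`pathOperator h t' ≤ pathOperator h t` pointwise, since `(1-t)(2-t) - (1-t')(2-t') = (t'-t)(3-t-t') ≥ 0`
and `R² ≥ 0` (the monotonicity behind "since `R_g > 0`, there exists `δ > -∞` so that `A^δ_g` is
positive definite", Gursky–Viaclovsky 2003, §3). [folklore] -/
theorem pathOperator_antitone
    (h : PseudoRiemannianMetric (𝓡 4) ∞ (EuclideanSpace ℝ (Fin 4)) (TangentSpace (𝓡 4) : M → Type _))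
    [h.HasLeviCivita] (x : M) {t t' : ℝ} (htt' : t ≤ t') (h3 : t + t' ≤ 3) :
    pathOperator h t' x ≤ pathOperator h t x := by
  rw [pathOperator_eq_pathOperator_one_add h t', pathOperator_eq_pathOperator_one_add h t]
  have hR : 0 ≤ h.scalarCurvature x ^ 2 := sq_nonneg _
  have hc : (1 - t') * (2 - t') ≤ (1 - t) * (2 - t) := by nlinarith [mul_nonneg (sub_nonneg.2 htt') (sub_nonneg.2 h3)]
  nlinarith [mul_le_mul_of_nonneg_right hc hR]

/-- A path solution is a Riemannian metric. [cite: GurskyViaclovsky2003, §5 (the set 𝒮)] -/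
theorem IsPathSolution.isRiemannian
    {g h : PseudoRiemannianMetric (𝓡 4) ∞ (EuclideanSpace ℝ (Fin 4)) (TangentSpace (𝓡 4) : M → Type _)}
    [h.HasLeviCivita] {u : M → ℝ} {t : ℝ} {q : M → ℝ} (hs : IsPathSolution g h u t q) :
    h.IsRiemannian :=
  hs.1

/-- The conformal factor of a path solution is smooth. [cite: GurskyViaclovsky2003, §5 (the set 𝒮)] -/
theorem IsPathSolution.contMDiff
    {g h : PseudoRiemannianMetric (𝓡 4) ∞ (EuclideanSpace ℝ (Fin 4)) (TangentSpace (𝓡 4) : M → Type _)}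
    [h.HasLeviCivita] {u : M → ℝ} {t : ℝ} {q : M → ℝ} (hs : IsPathSolution g h u t q) :
    ContMDiff (𝓡 4) 𝓘(ℝ) ∞ u :=
  hs.2.1

/-- A path solution is the conformal metric `h = e^{-2u} g`. [cite: GurskyViaclovsky2003, §5 (the set 𝒮)] -/
theorem IsPathSolution.val_eq
    {g h : PseudoRiemannianMetric (𝓡 4) ∞ (EuclideanSpace ℝ (Fin 4)) (TangentSpace (𝓡 4) : M → Type _)}
    [h.HasLeviCivita] {u : M → ℝ} {t : ℝ} {q : M → ℝ} (hs : IsPathSolution g h u t q)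
    (x : M) (v w : TangentSpace (𝓡 4) x) :
    h.val x v w = Real.exp (-2 * u x) * g.val x v w :=
  hs.2.2.1 x v w

/-- A path solution has positive scalar curvature (admissibility, `A^t ∈ Γ₂⁺`).
[cite: GurskyViaclovsky2003, §5 (the set 𝒮) and Def. 1] -/
theorem IsPathSolution.scalarCurvature_pos
    {g h : PseudoRiemannianMetric (𝓡 4) ∞ (EuclideanSpace ℝ (Fin 4)) (TangentSpace (𝓡 4) : M → Type _)}
    [h.HasLeviCivita] {u : M → ℝ} {t : ℝ} {q : M → ℝ} (hs : IsPathSolution g h u t q) (x : M) :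
    0 < h.scalarCurvature x :=
  hs.2.2.2.1 x

/-- A path solution solves the weighted path equation `pathOperator h t = q·e^{8u}`.
[cite: GurskyViaclovsky2003, §3 (path)] -/
theorem IsPathSolution.pathOperator_eq
    {g h : PseudoRiemannianMetric (𝓡 4) ∞ (EuclideanSpace ℝ (Fin 4)) (TangentSpace (𝓡 4) : M → Type _)}
    [h.HasLeviCivita] {u : M → ℝ} {t : ℝ} {q : M → ℝ} (hs : IsPathSolution g h u t q) (x : M) :
    pathOperator h t x = q x * Real.exp (8 * u x) :=
  hs.2.2.2.2 x

/-- The background metric of a path solution is Riemannian as well (`g = e^{2u} h` on each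
fibre). [folklore] -/
theorem IsPathSolution.isRiemannian_background
    {g h : PseudoRiemannianMetric (𝓡 4) ∞ (EuclideanSpace ℝ (Fin 4)) (TangentSpace (𝓡 4) : M → Type _)}
    [h.HasLeviCivita] {u : M → ℝ} {t : ℝ} {q : M → ℝ} (hs : IsPathSolution g h u t q) :
    g.IsRiemannian := by
  intro x v hv
  have h1 := hs.isRiemannian x v hv
  rw [hs.val_eq x v v] at h1
  exact pos_of_mul_pos_right h1 (Real.exp_pos _).le

/-- **`u ≡ 0` solves the path equation at parameter `t` with right-hand side `q = pathOperator g t`**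
("Note that `u ≡ 0` is a solution of (path) for `t = δ`", Gursky–Viaclovsky 2003, §3, where
`f = σ₂^{1/2}(g⁻¹A^δ_g)` is chosen for exactly this purpose), for a Riemannian background of
positive scalar curvature. [cite: GurskyViaclovsky2003, §3] -/
theorem isPathSolution_self
    (g : PseudoRiemannianMetric (𝓡 4) ∞ (EuclideanSpace ℝ (Fin 4)) (TangentSpace (𝓡 4) : M → Type _))
    [g.HasLeviCivita] (hg : g.IsRiemannian) (hR : ∀ x, 0 < g.scalarCurvature x) (t : ℝ) :
    IsPathSolution g g (fun _ ↦ 0) t (fun x ↦ pathOperator g t x) := by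
  refine ⟨hg, contMDiff_const, fun x v w ↦ ?_, hR, fun x ↦ ?_⟩
  · simp
  · simp

/-- **`𝒮` is non-empty**: with the right-hand side `q = pathOperator g t` the parameter `t` is
solvable, by `(h, u) = (g, 0)` (Gursky–Viaclovsky 2003, §5: "The function `f(x)` was chosen so that
`u ≡ 0` is a solution at `t = δ` … `𝒮` is nonempty"). [cite: GurskyViaclovsky2003, §5] -/
theorem solvable_self
    (g : PseudoRiemannianMetric (𝓡 4) ∞ (EuclideanSpace ℝ (Fin 4)) (TangentSpace (𝓡 4) : M → Type _))
    [g.HasLeviCivita] (hg : g.IsRiemannian) (hR : ∀ x, 0 < g.scalarCurvature x) (t : ℝ) :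
    Solvable g t (fun x ↦ pathOperator g t x) :=
  ⟨g, ‹g.HasLeviCivita›, fun _ ↦ 0, isPathSolution_self g hg hR t⟩

/-- **A solution at `t = 1` with positive right-hand side is pointwise pinched**:
`¼|W_h|² < σ₂(A_h)` everywhere — the conclusion (1.10) (`α = 1`) of Chang–Gursky–Yang 2003,
Thm. 1.4, for the conformal metric `h = e^{-2u} g`. [cite: ChangGurskyYang2003, Thm. 1.4, (1.10)] -/
theorem IsPathSolution.quarter_weylNormSq_lt
    {g h : PseudoRiemannianMetric (𝓡 4) ∞ (EuclideanSpace ℝ (Fin 4)) (TangentSpace (𝓡 4) : M → Type _)}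
    [h.HasLeviCivita] {u : M → ℝ} {q : M → ℝ} (hs : IsPathSolution g h u 1 q)
    (hq : ∀ x, 0 < q x) (x : M) :
    1 / 4 * h.weylNormSq x < h.sigma2WeylSchouten x := by
  have hx := hs.pathOperator_eq x
  have hqx : 0 < q x * Real.exp (8 * u x) := mul_pos (hq x) (Real.exp_pos _)
  rw [pathOperator_one] at hx
  linarith

/-- More generally, a solution at any `t ∈ [1, 2]` with positive right-hand side satisfies
`¼|W_h|² < σ₂(A_h)` pointwise, the correction `(1-t)(2-t)R²/6` being non-positive there.
[cite: ChangGurskyYang2003, Thm. 1.4, (1.10)] -/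
theorem IsPathSolution.quarter_weylNormSq_lt_of_mem_Icc
    {g h : PseudoRiemannianMetric (𝓡 4) ∞ (EuclideanSpace ℝ (Fin 4)) (TangentSpace (𝓡 4) : M → Type _)}
    [h.HasLeviCivita] {u : M → ℝ} {t : ℝ} {q : M → ℝ} (hs : IsPathSolution g h u t q)
    (hq : ∀ x, 0 < q x) (ht : t ∈ Set.Icc (1 : ℝ) 2) (x : M) :
    1 / 4 * h.weylNormSq x < h.sigma2WeylSchouten x := by
  have hx := hs.pathOperator_eq x
  have hqx : 0 < q x * Real.exp (8 * u x) := mul_pos (hq x) (Real.exp_pos _)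
  have hc : (1 - t) * (2 - t) * h.scalarCurvature x ^ 2 / 6 ≤ 0 := by
    have h1 : (1 - t) * (2 - t) ≤ 0 :=
      mul_nonpos_of_nonpos_of_nonneg (sub_nonpos.2 ht.1) (sub_nonneg.2 ht.2)
    have h2 : 0 ≤ h.scalarCurvature x ^ 2 := sq_nonneg _
    nlinarith [mul_nonpos_of_nonpos_of_nonneg h1 h2]
  simp only [pathOperator] at hx
  linarith

variable [T2Space M]

/-- **`κ(h) > 0` is Chang–Gursky–Yang's (1.2)**: `0 < kappa h ↔ ¼ ∫|W_h|² dV_h < ∫σ₂(A_h) dV_h`.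
[cite: ChangGurskyYang2003, (1.2) p. 111] -/
theorem kappa_pos_iff
    (h : PseudoRiemannianMetric (𝓡 4) ∞ (EuclideanSpace ℝ (Fin 4)) (TangentSpace (𝓡 4) : M → Type _))
    [h.HasLeviCivita] :
    0 < kappa h ↔ 1 / 4 * h.weylEnergy.toReal < h.sigma2WeylSchoutenIntegral :=
  sub_pos

/-- For a non-Riemannian `h` both integrals are junk `0`, so `κ(h) = 0`. [folklore] -/
theorem kappa_of_not_isRiemannian
    (h : PseudoRiemannianMetric (𝓡 4) ∞ (EuclideanSpace ℝ (Fin 4)) (TangentSpace (𝓡 4) : M → Type _))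
    [h.HasLeviCivita] (hh : ¬ h.IsRiemannian) : kappa h = 0 := by
  rw [kappa, h.sigma2WeylSchoutenIntegral_of_not_isRiemannian hh,
    h.weylEnergy_of_not_isRiemannian hh]
  simp

end API

/-! ### The model case: the round four-sphere

Non-vacuity of the vocabulary with the tree's definitions: on the round `S⁴` (constant sectional
curvature `1`, `R = 12`, `E = 0`, `W = 0`; Lee 2018, Prop. 8.36, Besse 1987, 1.118–1.119) the path
operator is the constant `6 + 24(1-t)(2-t)`, positive for `t ≤ 1`, so `(h, u) = (g_{round}, 0)` is a
smooth admissible solution with a positive constant right-hand side at every parameter of the path. -/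

section RoundSphere

open Metric

variable (V : Type*) [NormedAddCommGroup V] [InnerProductSpace ℝ V] [Fact (Module.finrank ℝ V = 4 + 1)]

/-- **The path operator of the round unit `S⁴`** is the constant `6 + 24(1-t)(2-t)`:
`σ₂(A) = -½|E|² + R²/24 = 144/24 = 6`, `|W|² = 0`, `(1-t)(2-t)R²/6 = 24(1-t)(2-t)` (round sphere:
`Ric = 3g`, `R = 12`, `W = 0`). [cite: Lee2018, Prop. 8.36] [cite: Besse1987, 1.118–1.119] -/
theorem pathOperator_roundMetric [(roundMetric (n := 4) V).HasLeviCivita] (t : ℝ)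
    (x : sphere (0 : V) 1) :
    pathOperator (roundMetric (n := 4) V) t x = 6 + 24 * ((1 - t) * (2 - t)) := by
  have hc := hasConstantSectionalCurvatureWith_roundMetric V
    (roundMetric (n := 4) V).isLeviCivita_leviCivita_holds
  have hE : Module.finrank ℝ (EuclideanSpace ℝ (Fin 4)) = 4 := finrank_euclideanSpace_fin
  have hW : (roundMetric (n := 4) V).weylNormSq x = 0 := hc.weylNormSq_eq_zero (by rw [hE]; norm_num) x
  have hEt : (roundMetric (n := 4) V).tracelessRicciNormSq x = 0 :=
    hc.tracelessRicciNormSq_eq_zero x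
  have hR : (roundMetric (n := 4) V).scalarCurvature x = 12 := by
    rw [scalarCurvature_roundMetric V x]
    norm_num
  have hpos := isRiemannian_roundMetric (n := 4) (V := V) x
  have hσ : (roundMetric (n := 4) V).sigma2WeylSchouten x = 6 := by
    rw [(roundMetric (n := 4) V).sigma2WeylSchouten_eq (WithTop.coe_le_coe.mpr le_top) hE hpos,
      hEt, hR]
    norm_num
  rw [pathOperator, hσ, hW, hR]
  ring

/-- On the round `S⁴` the path operator is positive for every `t ≤ 1` (indeed for `t ≠ 3/2`).
[cite: Lee2018, Prop. 8.36] -/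
theorem pathOperator_roundMetric_pos [(roundMetric (n := 4) V).HasLeviCivita] {t : ℝ} (ht : t ≤ 1)
    (x : sphere (0 : V) 1) : 0 < pathOperator (roundMetric (n := 4) V) t x := by
  rw [pathOperator_roundMetric V t x]
  nlinarith [mul_nonneg (sub_nonneg.2 ht) (by linarith : (0 : ℝ) ≤ 2 - t)]

/-- **The round `S⁴` solves the weighted path equation at every parameter**: `(h, u) = (g_{round}, 0)`
is a smooth admissible solution with the constant right-hand side `q ≡ 6 + 24(1-t)(2-t)` (positive
for `t ≤ 1`, `pathOperator_roundMetric_pos`) — a non-vacuity certificate for `IsPathSolution` and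
`Solvable`. [cite: GurskyViaclovsky2003, §3] [cite: Lee2018, Prop. 8.36] -/
theorem isPathSolution_roundMetric [(roundMetric (n := 4) V).HasLeviCivita] (t : ℝ) :
    IsPathSolution (roundMetric (n := 4) V) (roundMetric (n := 4) V) (fun _ ↦ 0) t
      (fun _ ↦ 6 + 24 * ((1 - t) * (2 - t))) := by
  refine ⟨isRiemannian_roundMetric, contMDiff_const, fun x v w ↦ by simp,
    fun x ↦ scalarCurvature_roundMetric_pos V (by norm_num) x, fun x ↦ ?_⟩
  simp only [mul_zero, Real.exp_zero, mul_one]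
  exact pathOperator_roundMetric V t x

/-- Hence every parameter is solvable on the round `S⁴` for the right-hand side
`q ≡ 6 + 24(1-t)(2-t)`. [cite: GurskyViaclovsky2003, §5] -/
theorem solvable_roundMetric (t : ℝ) :
    Solvable (roundMetric (n := 4) V) t (fun _ ↦ 6 + 24 * ((1 - t) * (2 - t))) :=
  haveI : (roundMetric (n := 4) V).HasLeviCivita := (roundMetric (n := 4) V).hasLeviCivita
  ⟨roundMetric (n := 4) V, ‹_›, fun _ ↦ 0, isPathSolution_roundMetric V t⟩

end RoundSphere

end Literature.Geometry.Riemannian.GurskyViaclovskyPath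

end
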